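import Literature.NumberTheory.Automorphic.UnitaryGroupLocalReflections        -- ★ `reflMatrix_mulVec`, `reflMatrix_mul_reflMatrix` (quasi-reflections `1 + a • u ⊗ r`)
import Literature.NumberTheory.Automorphic.UnitaryGroupIsotropicLineElements    -- ★ `hermRow`, `hermForm` sesquilinearity, isometry criterion, `conj_hermForm`
import Literature.NumberTheory.Automorphic.LocalUnitaryGroupCongr               -- ★ `localNonsplitEquiv` (one-place model), `isUnit_placeForm_of_isUnit_det`
import Literature.NumberTheory.Automorphic.UnitaryGroupInertPlaceHyperbolicBasis -- ★ `placeForm_hermitian_of_smul_eq`, `galAdicCompletionMap_galAdicCompletionMap_of_smul_eq`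
import HarnessLib

/-!
# The centre of a unitary group consists of scalars

For a field `K` with an involution `σ` (`σ σ = id`), a `σ`-hermitian INVERTIBLE Gram matrix `H` (`(σ H)ᵀ = H`, `det H ≠ 0`) and
`2, 3 ≠ 0` in `K`, **every element of the centre of the unitary group `U(σ, H) = {g ∈ GL_n(K) | (σ g)ᵀ H g = H}` is a scalar
matrix `u · 1_n`** (`exists_coe_eq_scalar_of_mem_center_unitaryGroupOfForm`).  Proof by quasi-REFLECTIONS (no diagonalisation, no
Zariski density): along an anisotropic `p` (`h(p,p) ≠ 0`) the reflection `R_p = 1 − (2 ∕ h(p,p)) · p ⊗ h(p, ·)` lies in `U(σ, H)`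
(§1); a central `z` commutes with `R_p`, hence `h(p,q) · z p = h(p, z q) · p` for all `q`, so `z p = λ_p p` and `λ_p = λ_q` whenever
`h(p,q) ≠ 0` (§2); an anisotropic `x₀` exists (`H ≠ 0`, polarisation), every anisotropic `p` has `λ_p = λ_{x₀}` (through `x₀ + t p`,
`t ∈ {1, 2}`), and every isotropic `y` is reached through an anisotropic `x₀ + t y`, `t ∈ {1, 2}` (§3).

§4 transports this to the tree's local unitary group at a NON-SPLIT place: for a quadratic extension `E ∕ F` of number fields with
conjugation `c ≠ 1`, `J` `c`-hermitian with `det J` a unit, and a finite place `v` of `F` all of whose extensions `w ∣ v` are fixed by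
`c`, every central element of `U(J)(F_v) = «local» E c N J v ≤ GL_N(∏_{w ∣ v} E_w)` is a scalar `u · 1_N`, `u ∈ (∏_{w ∣ v} E_w)^×`
(`forall_mem_center_local_eq_scalar`; one-place model ★ `localNonsplitEquiv`, `σ_w`-hermitian `J_w` ★ `placeForm_hermitian_of_smul_eq`),
and the CM packaging `forall_mem_center_cmLocal_eq_scalar` — the input `hle` of ★ `F0P3bLocalNonsplitCompactCenter` (compact centre of
`U(H)(L⁺_v)`, Ob1 pay-down of crux H413).  Theorems only; no `def`, no instance.
[cite: PlatonovRapinchuk1994, §2.3 (unitary groups; centre = norm-one scalars)] [cite: Dieudonne1971GroupesClassiques, Chap. II §4–§5]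
-/

set_option autoImplicit false

noncomputable section

open NumberField IsDedekindDomain
open scoped Matrix

namespace Literature.NumberTheory.Automorphic.UnitaryGroup

/-! ## §1 Quasi-reflections along anisotropic vectors are unitary involutions -/

section Field

variable {K : Type*} [Field K] (σ : K →+* K) {n : Type*} [Fintype n] [DecidableEq n] (H : Matrix n n K)

/-- The action of `1 + α · p ⊗ h(p, ·)`: `v ↦ v + α h(p, v) p`. [cite: Dieudonne1971GroupesClassiques, Chap. II §4] -/
theorem hermRefl_mulVec (p v : n → K) (α : K) :
    (1 + α • Matrix.vecMulVec p (hermRow σ H p)) *ᵥ v = v + (α * hermForm σ H p v) • p := by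
  rw [reflMatrix_mulVec, hermRow_dotProduct]

/-- The reflection `R_p = 1 − (2 ∕ h(p,p)) · p ⊗ h(p, ·)` along an anisotropic `p` is an involution: `R_p R_p = 1`.
[cite: Dieudonne1971GroupesClassiques, Chap. II §4] -/
theorem hermRefl_mul_self {p : n → K} (hp : hermForm σ H p p ≠ 0) :
    (1 + (-(2 * (hermForm σ H p p)⁻¹)) • Matrix.vecMulVec p (hermRow σ H p)) *
        (1 + (-(2 * (hermForm σ H p p)⁻¹)) • Matrix.vecMulVec p (hermRow σ H p)) = 1 := by
  rw [reflMatrix_mul_reflMatrix, hermRow_dotProduct]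
  have hinv : (hermForm σ H p p)⁻¹ * hermForm σ H p p = 1 := inv_mul_cancel₀ hp
  have h0 : -(2 * (hermForm σ H p p)⁻¹) + -(2 * (hermForm σ H p p)⁻¹) +
      -(2 * (hermForm σ H p p)⁻¹) * -(2 * (hermForm σ H p p)⁻¹) * hermForm σ H p p = 0 := by
    linear_combination (4 * (hermForm σ H p p)⁻¹) * hinv
  rw [h0, zero_smul, add_zero]

/-- **The reflection along an anisotropic vector is unitary**: `(σ R_p)ᵀ H R_p = H` for `σ` an involution and `H` `σ`-hermitian
(isometry criterion ★ `transpose_map_mul_mul_eq_iff_hermForm`: `h(R_p v, R_p w) = h(v, w)`). [cite: Dieudonne1971GroupesClassiques, Chap. II §4] -/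
theorem transpose_map_hermRefl_mul (hσ : ∀ t, σ (σ t) = t) (hH : (H.map σ)ᵀ = H) {p : n → K} (hp : hermForm σ H p p ≠ 0) :
    ((1 + (-(2 * (hermForm σ H p p)⁻¹)) • Matrix.vecMulVec p (hermRow σ H p)).map σ)ᵀ * H *
        (1 + (-(2 * (hermForm σ H p p)⁻¹)) • Matrix.vecMulVec p (hermRow σ H p)) = H := by
  rw [transpose_map_mul_mul_eq_iff_hermForm]
  intro v w
  have ha : σ (hermForm σ H p p) = hermForm σ H p p := conj_hermForm σ H hσ hH p p
  have hα : σ (-(2 * (hermForm σ H p p)⁻¹)) = -(2 * (hermForm σ H p p)⁻¹) := by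
    rw [map_neg, map_mul, map_ofNat, map_inv₀, ha]
  rw [hermRefl_mulVec, hermRefl_mulVec, hermForm_add_left, hermForm_add_right, hermForm_add_right, hermForm_smul_right,
    hermForm_smul_right, hermForm_smul_left_eq, hermForm_smul_left_eq, map_mul, hα, conj_hermForm σ H hσ hH p v]
  have hinv : (hermForm σ H p p)⁻¹ * hermForm σ H p p = 1 := inv_mul_cancel₀ hp
  linear_combination (4 * (hermForm σ H p p)⁻¹ * hermForm σ H v p * hermForm σ H p w) * hinv

/-- The reflection along an anisotropic `p`, as an element of `U(σ, H) ≤ GL_n(K)`. [cite: Dieudonne1971GroupesClassiques, Chap. II §4] -/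
theorem exists_mem_unitaryGroupOfForm_coe_eq_hermRefl (hσ : ∀ t, σ (σ t) = t) (hH : (H.map σ)ᵀ = H) {p : n → K}
    (hp : hermForm σ H p p ≠ 0) :
    ∃ r ∈ unitaryGroupOfForm σ H,
      ((r : GL n K) : Matrix n n K) = 1 + (-(2 * (hermForm σ H p p)⁻¹)) • Matrix.vecMulVec p (hermRow σ H p) :=
  ⟨⟨_, _, hermRefl_mul_self σ H hp, hermRefl_mul_self σ H hp⟩, by
    rw [mem_unitaryGroupOfForm_iff]
    exact transpose_map_hermRefl_mul σ H hσ hH hp, rfl⟩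

/-! ## §2 A central element commutes with every reflection: eigenvectors and eigenvalues -/

/-- A CENTRAL element of `U(σ, H)` commutes, as a matrix, with the reflection along every anisotropic `p`.
[cite: Dieudonne1971GroupesClassiques, Chap. II §5] -/
theorem coe_mul_hermRefl_comm (hσ : ∀ t, σ (σ t) = t) (hH : (H.map σ)ᵀ = H) {z : unitaryGroupOfForm σ H}
    (hz : z ∈ Subgroup.center (unitaryGroupOfForm σ H)) {p : n → K} (hp : hermForm σ H p p ≠ 0) :
    ((z : GL n K) : Matrix n n K) * (1 + (-(2 * (hermForm σ H p p)⁻¹)) • Matrix.vecMulVec p (hermRow σ H p)) =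
      (1 + (-(2 * (hermForm σ H p p)⁻¹)) • Matrix.vecMulVec p (hermRow σ H p)) * ((z : GL n K) : Matrix n n K) := by
  obtain ⟨r, hr, hre⟩ := exists_mem_unitaryGroupOfForm_coe_eq_hermRefl σ H hσ hH hp
  have h := Subgroup.mem_center_iff.1 hz ⟨r, hr⟩
  have h' := congrArg (fun g : unitaryGroupOfForm σ H => ((g : GL n K) : Matrix n n K)) h
  simp only [Subgroup.coe_mul, Units.val_mul, hre] at h'
  exact h'.symm

/-- **The reflection identity for a commuting matrix**: if `Z` commutes with `R_p` (`h(p,p) ≠ 0`, `2 ≠ 0`), then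
`h(p, q) · Z p = h(p, Z q) · p` for every `q`. [cite: Dieudonne1971GroupesClassiques, Chap. II §5] -/
theorem hermForm_smul_mulVec_eq_of_comm (h2 : (2 : K) ≠ 0) {Z : Matrix n n K} {p : n → K} (hp : hermForm σ H p p ≠ 0)
    (hcomm : Z * (1 + (-(2 * (hermForm σ H p p)⁻¹)) • Matrix.vecMulVec p (hermRow σ H p)) =
      (1 + (-(2 * (hermForm σ H p p)⁻¹)) • Matrix.vecMulVec p (hermRow σ H p)) * Z) (q : n → K) :
    hermForm σ H p q • (Z *ᵥ p) = hermForm σ H p (Z *ᵥ q) • p := by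
  have h := congrArg (fun M : Matrix n n K => M *ᵥ q) hcomm
  rw [← Matrix.mulVec_mulVec, ← Matrix.mulVec_mulVec, hermRefl_mulVec, hermRefl_mulVec, Matrix.mulVec_add,
    Matrix.mulVec_smul] at h
  have h' := add_left_cancel h
  rw [mul_smul, mul_smul] at h'
  exact smul_right_injective (n → K) (neg_ne_zero.2 (mul_ne_zero h2 (inv_ne_zero hp))) h'

/-- **Anisotropic vectors are eigenvectors** of a matrix commuting with their reflection: `Z p = (h(p,p)⁻¹ h(p, Z p)) · p`.
[cite: Dieudonne1971GroupesClassiques, Chap. II §5] -/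
theorem mulVec_eq_smul_of_comm (h2 : (2 : K) ≠ 0) {Z : Matrix n n K} {p : n → K} (hp : hermForm σ H p p ≠ 0)
    (hcomm : Z * (1 + (-(2 * (hermForm σ H p p)⁻¹)) • Matrix.vecMulVec p (hermRow σ H p)) =
      (1 + (-(2 * (hermForm σ H p p)⁻¹)) • Matrix.vecMulVec p (hermRow σ H p)) * Z) :
    Z *ᵥ p = ((hermForm σ H p p)⁻¹ * hermForm σ H p (Z *ᵥ p)) • p := by
  have h := hermForm_smul_mulVec_eq_of_comm σ H h2 hp hcomm p
  rw [mul_smul, ← h, smul_smul, inv_mul_cancel₀ hp, one_smul]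

omit [DecidableEq n] in
/-- **Eigenvalue comparison**: if `h(p,q) · Z p = h(p, Z q) · p`, `Z p = λ p`, `Z q = μ q`, `p ≠ 0` and `h(p, q) ≠ 0`, then `λ = μ`.
[cite: Dieudonne1971GroupesClassiques, Chap. II §5] -/
theorem eigenvalue_eq_of_hermForm_ne_zero {Z : Matrix n n K} {p q : n → K} {lam mu : K} (hp0 : p ≠ 0)
    (hkey : hermForm σ H p q • (Z *ᵥ p) = hermForm σ H p (Z *ᵥ q) • p) (hZp : Z *ᵥ p = lam • p) (hZq : Z *ᵥ q = mu • q)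
    (hpq : hermForm σ H p q ≠ 0) : lam = mu := by
  rw [hZp, hZq, hermForm_smul_right, smul_smul] at hkey
  have h := smul_left_injective K hp0 hkey
  exact mul_left_cancel₀ hpq (h.trans (mul_comm _ _))

/-! ## §3 Anisotropic vectors exist and span: the centre is scalar -/

/-- `h(x + t y, x + t y) = h(x,x) + t h(x,y) + t h(y,x) + t² h(y,y)` for `σ`-fixed `t`. [cite: Dieudonne1971GroupesClassiques, Chap. II §4] -/
theorem hermForm_add_smul_self (x y : n → K) {t : K} (ht : σ t = t) :
    hermForm σ H (x + t • y) (x + t • y) =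
      hermForm σ H x x + t * hermForm σ H x y + t * hermForm σ H y x + t * t * hermForm σ H y y := by
  rw [hermForm_add_left, hermForm_add_right, hermForm_add_right, hermForm_smul_right, hermForm_smul_left_eq,
    hermForm_smul_left_eq, hermForm_smul_right, ht]
  ring

/-- **An anisotropic vector exists** for a non-zero `σ`-hermitian `H` (`σ` an involution, `2 ≠ 0`): otherwise all `H_{ii} = h(e_i, e_i) = 0`
and `h(e_i + H_{ij}⁻¹ e_j, e_i + H_{ij}⁻¹ e_j) = 2`. [cite: Dieudonne1971GroupesClassiques, Chap. II §4] -/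
theorem exists_hermForm_self_ne_zero (hH : (H.map σ)ᵀ = H) (h2 : (2 : K) ≠ 0) (hH0 : H ≠ 0) :
    ∃ x : n → K, hermForm σ H x x ≠ 0 := by
  by_contra hall
  push Not at hall
  have hji : ∀ i j, σ (H i j) = H j i := fun i j => by
    have h := congrFun (congrFun hH j) i
    rwa [Matrix.transpose_apply, Matrix.map_apply] at h
  have hdiag : ∀ i, H i i = 0 := fun i => by rw [← hermForm_single_single σ H i i]; exact hall _
  apply hH0
  ext i j
  rw [Matrix.zero_apply]
  by_contra hij
  have hji0 : H j i ≠ 0 := by rw [← hji]; exact (map_ne_zero σ).2 hij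
  have h := hall (Pi.single i 1 + (H i j)⁻¹ • Pi.single j 1)
  rw [hermForm_add_left, hermForm_add_right, hermForm_add_right, hermForm_smul_right, hermForm_smul_left_eq,
    hermForm_smul_left_eq, hermForm_smul_right, hermForm_single_single, hermForm_single_single, hermForm_single_single,
    hermForm_single_single, hdiag, hdiag, map_inv₀, hji, inv_mul_cancel₀ hij, inv_mul_cancel₀ hji0] at h
  have h2' : (2 : K) = 0 := by linear_combination h
  exact h2 h2'

/-- **The centre of `U(σ, H)` is scalar.**  For a field `K` with `2, 3 ≠ 0`, an involution `σ`, and a `σ`-hermitian `H` with `det H ≠ 0`,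
every `z` in the centre of `unitaryGroupOfForm σ H ≤ GL_n(K)` is `u · 1_n` for a unit `u` (necessarily `σ(u) u = 1`).  Reflections along
anisotropic vectors (§1–§2) make every anisotropic vector an eigenvector with a common eigenvalue, and isotropic vectors are differences of
anisotropic ones. [cite: PlatonovRapinchuk1994, §2.3] [cite: Dieudonne1971GroupesClassiques, Chap. II §5] -/
theorem exists_coe_eq_scalar_of_mem_center_unitaryGroupOfForm (hσ : ∀ t, σ (σ t) = t) (hH : (H.map σ)ᵀ = H) (hHd : H.det ≠ 0)
    (h2 : (2 : K) ≠ 0) (h3 : (3 : K) ≠ 0) {z : unitaryGroupOfForm σ H} (hz : z ∈ Subgroup.center (unitaryGroupOfForm σ H)) :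
    ∃ u : Kˣ, (z : GL n K) = Matrix.GeneralLinearGroup.scalar n u := by
  rcases isEmpty_or_nonempty n with hn | hn
  · exact ⟨1, Units.ext (Matrix.ext fun i _ => isEmptyElim i)⟩
  set Z : Matrix n n K := ((z : GL n K) : Matrix n n K) with hZdef
  have hH0 : H ≠ 0 := by
    rintro rfl
    exact hHd Matrix.det_zero
  obtain ⟨x₀, hx₀⟩ := exists_hermForm_self_ne_zero σ H hH h2 hH0
  -- the reflection identity and the eigenvector property for every anisotropic `p`
  have hkey : ∀ p, hermForm σ H p p ≠ 0 → ∀ q, hermForm σ H p q • (Z *ᵥ p) = hermForm σ H p (Z *ᵥ q) • p :=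
    fun p hp => hermForm_smul_mulVec_eq_of_comm σ H h2 hp (coe_mul_hermRefl_comm σ H hσ hH hz hp)
  have heig : ∀ p, hermForm σ H p p ≠ 0 → Z *ᵥ p = ((hermForm σ H p p)⁻¹ * hermForm σ H p (Z *ᵥ p)) • p :=
    fun p hp => mulVec_eq_smul_of_comm σ H h2 hp (coe_mul_hermRefl_comm σ H hσ hH hz hp)
  have hne : ∀ p, hermForm σ H p p ≠ 0 → p ≠ 0 := by
    rintro p hp rfl
    exact hp (hermForm_zero_left σ H 0)
  -- comparison of eigenvalues along a non-orthogonal pair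
  have hcmp : ∀ p q (cp cq : K), hermForm σ H p p ≠ 0 → Z *ᵥ p = cp • p → Z *ᵥ q = cq • q → hermForm σ H p q ≠ 0 → cp = cq :=
    fun p q cp cq hp hZp hZq hpq => eigenvalue_eq_of_hermForm_ne_zero σ H (hne p hp) (hkey p hp q) hZp hZq hpq
  set lam : K := (hermForm σ H x₀ x₀)⁻¹ * hermForm σ H x₀ (Z *ᵥ x₀) with hlam
  have hZx₀ : Z *ᵥ x₀ = lam • x₀ := heig x₀ hx₀
  -- Step A: every anisotropic vector has eigenvalue `lam`
  have hA : ∀ p, hermForm σ H p p ≠ 0 → Z *ᵥ p = lam • p := by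
    intro p hp
    have hZp := heig p hp
    suffices hc : (hermForm σ H p p)⁻¹ * hermForm σ H p (Z *ᵥ p) = lam by rwa [hc] at hZp
    by_cases hpq : hermForm σ H x₀ p = 0
    · -- `x₀ ⊥ p`: pass through `u = x₀ + t p`, `t ∈ {1, 2}`, anisotropic since `h(u,u) = h(x₀,x₀) + t² h(p,p)`
      have hqp : hermForm σ H p x₀ = 0 := by rw [← conj_hermForm σ H hσ hH x₀ p, hpq, map_zero]
      obtain ⟨t, ht0, hσt, hval⟩ : ∃ t : K, t ≠ 0 ∧ σ t = t ∧
          hermForm σ H x₀ x₀ + t * t * hermForm σ H p p ≠ 0 := by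
        by_cases h1 : hermForm σ H x₀ x₀ + hermForm σ H p p = 0
        · refine ⟨2, h2, map_ofNat σ 2, fun h => hp ?_⟩
          have h3b : (3 : K) * hermForm σ H p p = 0 := by linear_combination h - h1
          exact (mul_eq_zero.1 h3b).resolve_left h3
        · exact ⟨1, one_ne_zero, map_one σ, by rwa [one_mul, one_mul]⟩
      have hu : hermForm σ H (x₀ + t • p) (x₀ + t • p) ≠ 0 := by
        rw [hermForm_add_smul_self σ H x₀ p hσt, hpq, hqp, mul_zero, add_zero, add_zero]
        exact hval
      have hux : hermForm σ H (x₀ + t • p) x₀ ≠ 0 := by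
        rw [hermForm_add_left, hermForm_smul_left_eq, hqp, mul_zero, add_zero]
        exact hx₀
      have hup : hermForm σ H (x₀ + t • p) p ≠ 0 := by
        rw [hermForm_add_left, hermForm_smul_left_eq, hpq, zero_add, hσt]
        exact mul_ne_zero ht0 hp
      have hZu := heig _ hu
      have e1 := hcmp _ _ _ _ hu hZu hZx₀ hux
      have e2 := hcmp _ _ _ _ hu hZu hZp hup
      exact e2.symm.trans e1
    · exact (hcmp x₀ p lam _ hx₀ hZx₀ hZp hpq).symm
  -- Step B: every vector has eigenvalue `lam` (isotropic ones through an anisotropic `x₀ + t y`, `t ∈ {1, 2}`)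
  have hB : ∀ y, Z *ᵥ y = lam • y := by
    intro y
    by_cases hy : hermForm σ H y y = 0
    swap
    · exact hA y hy
    obtain ⟨t, ht0, hσt, hval⟩ : ∃ t : K, t ≠ 0 ∧ σ t = t ∧
        hermForm σ H x₀ x₀ + t * hermForm σ H x₀ y + t * hermForm σ H y x₀ ≠ 0 := by
      by_cases h1 : hermForm σ H x₀ x₀ + hermForm σ H x₀ y + hermForm σ H y x₀ = 0
      · exact ⟨2, h2, map_ofNat σ 2, fun h => hx₀ (by linear_combination 2 * h1 - h)⟩
      · exact ⟨1, one_ne_zero, map_one σ, by rwa [one_mul, one_mul]⟩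
    have hu : hermForm σ H (x₀ + t • y) (x₀ + t • y) ≠ 0 := by
      rw [hermForm_add_smul_self σ H x₀ y hσt, hy, mul_zero, add_zero]
      exact hval
    have hZu := hA _ hu
    rw [Matrix.mulVec_add, Matrix.mulVec_smul, hZx₀, smul_add, smul_comm lam t y] at hZu
    exact smul_right_injective (n → K) ht0 (add_left_cancel hZu)
  -- conclusion: `Z = lam • 1`
  have hcol : ∀ i j, Z i j = if i = j then lam else 0 := by
    intro i j
    have h := congr_fun (hB (Pi.single j 1)) i
    rwa [Matrix.mulVec_single_one, Matrix.col_apply, Pi.smul_apply, Pi.single_apply, smul_eq_mul, mul_ite, mul_one,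
      mul_zero] at h
  have hlam0 : lam ≠ 0 := by
    intro h0
    have hZ0 : Z = 0 := by
      ext i j
      rw [hcol, h0, ite_self, Matrix.zero_apply]
    have hu : IsUnit Z := (z : GL n K).isUnit
    rw [hZ0, Matrix.isUnit_iff_isUnit_det, Matrix.det_zero] at hu
    exact not_isUnit_zero hu
  refine ⟨Units.mk0 lam hlam0, Units.ext ?_⟩
  rw [Matrix.GeneralLinearGroup.coe_scalar, Units.val_mk0]
  ext i j
  rw [← hZdef, hcol, Matrix.scalar_apply, Matrix.diagonal_apply]

end Field

/-! ## §4 The local unitary group at a non-split place: central ⇒ scalar -/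

section Local

variable {F E : Type} [Field F] [NumberField F] [Field E] [NumberField E] [Algebra F E] [Algebra.IsQuadraticExtension F E]
  (c : E ≃ₐ[F] E) {N : ℕ} (J : Matrix (Fin N) (Fin N) E) (v : HeightOneSpectrum (𝓞 F))

/-- The one-place model ★ `localNonsplitEquiv` carries the centre of `U(J)(F_v)` into the centre of `U(σ_w, J_w)(E_w)`.
[cite: PlatonovRapinchuk1994, §5.1] -/
theorem localNonsplitEquiv_mem_center (hc : c ≠ 1) (w : PlacesOver E v) (hw : c • w.1 = w.1) {z : «local» E c N J v}
    (hz : z ∈ Subgroup.center («local» E c N J v)) :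
    localNonsplitEquiv c J hc w hw z ∈
      Subgroup.center (unitaryGroupOfForm (galAdicCompletionMap (L := E) c hw) (placeForm J w.1)) := by
  rw [Subgroup.mem_center_iff] at hz ⊢
  intro g
  obtain ⟨g', rfl⟩ : ∃ g', localNonsplitEquiv c J hc w hw g' = g :=
    ⟨(localNonsplitEquiv c J hc w hw).symm g, ContinuousMulEquiv.apply_symm_apply _ _⟩
  rw [← map_mul, ← map_mul, hz]

/-- **Central elements of `U(J)(F_v)` are scalar at a non-split place.**  For `c ≠ 1` the conjugation of the quadratic extension `E ∕ F`,
`J` `c`-hermitian with `det J` a unit, and `v` a finite place of `F` whose extensions `w ∣ v` are all fixed by `c`, every `z` in the centre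
of `«local» E c N J v ≤ GL_N(∏_{w ∣ v} E_w)` is `u · 1_N` with `u ∈ (∏_{w ∣ v} E_w)^×` (place by place, `exists_coe_eq_scalar_of_mem_center_unitaryGroupOfForm`
over the field `E_w` in the one-place model ★ `localNonsplitEquiv`, with ★ `placeForm_hermitian_of_smul_eq` and
★ `galAdicCompletionMap_galAdicCompletionMap_of_smul_eq`). [cite: PlatonovRapinchuk1994, §2.3; §5.1] -/
theorem forall_mem_center_local_eq_scalar (hc : c ≠ 1) (hJh : (J.map c)ᵀ = J) (hJ : IsUnit J.det)
    (hns : ∀ w : PlacesOver E v, c • w.1 = w.1) :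
    ∀ z ∈ Subgroup.center («local» E c N J v),
      ∃ u : (LocalRing E v)ˣ, (z : GL (Fin N) (LocalRing E v)) = Matrix.GeneralLinearGroup.scalar (Fin N) u := by
  intro z hz
  have key : ∀ w : PlacesOver E v, ∃ uw : (w.1.adicCompletion E)ˣ,
      ((z : GL (Fin N) (LocalRing E v)) : Matrix (Fin N) (Fin N) (LocalRing E v)).map
          (Pi.evalRingHom (fun w' : PlacesOver E v => w'.1.adicCompletion E) w) =
        Matrix.scalar (Fin N) (uw : w.1.adicCompletion E) := by
    intro w
    haveI : CharZero (w.1.adicCompletion E) :=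
      charZero_of_injective_algebraMap (algebraMap E (w.1.adicCompletion E)).injective
    obtain ⟨uw, huw⟩ := exists_coe_eq_scalar_of_mem_center_unitaryGroupOfForm (galAdicCompletionMap (L := E) c (hns w))
      (placeForm J w.1) (galAdicCompletionMap_galAdicCompletionMap_of_smul_eq c w hc (hns w))
      (placeForm_hermitian_of_smul_eq c w J hJh (hns w))
      ((Matrix.isUnit_iff_isUnit_det _).1 (isUnit_placeForm_of_isUnit_det hJ w.1)).ne_zero two_ne_zero three_ne_zero
      (localNonsplitEquiv_mem_center c J v hc w (hns w) hz)
    refine ⟨uw, ?_⟩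
    rw [← Matrix.GeneralLinearGroup.coe_scalar, ← huw]
    rfl
  choose U hU using key
  refine ⟨MulEquiv.piUnits.symm U, Units.ext (Matrix.ext fun i j => funext fun w => ?_)⟩
  have e := congr_fun (congr_fun (hU w) i) j
  rw [Matrix.map_apply, Pi.evalRingHom_apply] at e
  rw [e, Matrix.GeneralLinearGroup.coe_scalar, Matrix.scalar_apply, Matrix.scalar_apply, Matrix.diagonal_apply,
    Matrix.diagonal_apply]
  split_ifs <;> rfl

/-- **CM packaging** (`L` a CM field, `c` = complex conjugation, `H` hermitian with `det H` a unit): at a finite place `v` of `L⁺` that does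
not split in `L`, every central element of `U(H)(L⁺_v) = «local» L c̄ N H v` is a scalar — the input `hle` of ★
`F0P3bLocalNonsplitCompactCenter.local_nonsplit_compactOpen_center_of_center_le` (compact centre). [cite: PlatonovRapinchuk1994, §2.3; §5.1]
[cite: Rogawski1990, §12.2 p. 173] -/
theorem forall_mem_center_cmLocal_eq_scalar (L : Type) [Field L] [NumberField L] [IsCMField L] {N : ℕ}
    (H : Matrix (Fin N) (Fin N) L) (hH : (H.map (cmConjRingHom L))ᵀ = H) (hHd : IsUnit H.det)
    (v : HeightOneSpectrum (𝓞 ↥(maximalRealSubfield L))) (hns : ∀ w : PlacesOver L v, IsCMField.complexConj L • w.1 = w.1) :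
    ∀ z ∈ Subgroup.center («local» L (IsCMField.complexConj L) N H v),
      ∃ u : (LocalRing L v)ˣ, (z : GL (Fin N) (LocalRing L v)) = Matrix.GeneralLinearGroup.scalar (Fin N) u :=
  forall_mem_center_local_eq_scalar (IsCMField.complexConj L) H v (IsCMField.complexConj_ne_one L) hH hHd hns

end Local

end Literature.NumberTheory.Automorphic.UnitaryGroup

end
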